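import Summits.CriticalPhenomena.CardyFormulaZ2.Theorems.CardyBoundaryCoulombGasHalfPlaneMarkDensityLawWiredOfJointLimit
import Summits.CriticalPhenomena.CardyFormulaZ2.Theorems.CardyBoundaryCoulombGasHalfPlaneMarkDensityLawWiredSelfDualConstraint

/-!
# `HalfPlaneMarkDensityLaw` (crux stmt-CriticalPhenomena-5661), line `Sketch`, cycle 8 (`WiredDual`), lead c12-0:
# assembly — **the self-duality constraint on every joint subsequential limit**

For every joint subsequential limit `G` of `P_n(a,b,c,y)` along a strictly increasing `θ` and `σ, x > 0`, the monotone
limit `W_G(σ,x) := lim_{M→∞} G(−M, −σ, 1/M, x)` exists and is the limit along `θ` of the wired kernel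
(`stub_wired_of_jointLimit`, p-landed), and **`W_G(σ,x) + W_G(x,σ) = 1`** (`stub_jointLimit_selfDualConstraint`), in
particular **`lim_M G(−M,−σ,1/M,σ) = 1/2`** (`wiredLimit_diag`): the exact non-linear identity that every joint limit
inherits from the self-duality of bond-`ℤ²` at `p = 1/2` — the one a-priori constraint not coming from RSW and the
lattice symmetries.
-/

noncomputable section

namespace Summit.CriticalPhenomena.CardyFormulaZ2.Cruxes.HalfPlaneMarkDensityLaw.SketchLine

open Literature.Probability.Percolation Literature.Probability.LatticeModels
open MeasureTheory Filter Set
open scoped Topology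
open Summit.CriticalPhenomena.CardyFormulaZ2.Theorems.HalfPlaneMarkDensityLaw.Negative

namespace WiredDual

/-- **W2. `W_G(σ,x) + W_G(x,σ) = 1`** for every joint subsequential limit `G`. [folklore] -/
theorem stub_jointLimit_selfDualConstraint :
    ∀ {θ : ℕ → ℕ} {G : ℝ → ℝ → ℝ → ℝ → ℝ},
      (∀ a b c y : ℝ, a < b → b < c → c < y →
        Tendsto (fun n ↦ μ.real (openCrossing halfPlane (arcA a b (θ n))
          (rowIcc ⌊c * (θ n : ℕ)⌋ ⌊y * (θ n : ℕ)⌋))) atTop (𝓝 (G a b c y))) →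
      StrictMono θ → ∀ σ x : ℝ, 0 < σ → 0 < x → ∀ W₁ W₂ : ℝ,
        Tendsto (fun M : ℕ ↦ G (-(M : ℝ)) (-σ) ((M : ℝ)⁻¹) x) atTop (𝓝 W₁) →
        Tendsto (fun M : ℕ ↦ G (-(M : ℝ)) (-x) ((M : ℝ)⁻¹) σ) atTop (𝓝 W₂) → W₁ + W₂ = 1 :=
  stub_jointLimit_selfDualConstraint_of stub_wired_of_jointLimit

/-- **On the diagonal: `lim_M G(−M,−σ,1/M,σ) = 1/2`** for every joint subsequential limit and every `σ > 0`. [folklore] -/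
theorem wiredLimit_diag {θ : ℕ → ℕ} {G : ℝ → ℝ → ℝ → ℝ → ℝ}
    (hG : ∀ a b c y : ℝ, a < b → b < c → c < y →
      Tendsto (fun n ↦ μ.real (openCrossing halfPlane (arcA a b (θ n))
        (rowIcc ⌊c * (θ n : ℕ)⌋ ⌊y * (θ n : ℕ)⌋))) atTop (𝓝 (G a b c y)))
    (hθ : StrictMono θ) {σ : ℝ} (hσ : 0 < σ) :
    Tendsto (fun M : ℕ ↦ G (-(M : ℝ)) (-σ) ((M : ℝ)⁻¹) σ) atTop (𝓝 (1 / 2)) := by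
  obtain ⟨W, hW, -⟩ := stub_wired_of_jointLimit hG hθ σ σ hσ hσ
  have h := stub_jointLimit_selfDualConstraint hG hθ σ σ hσ hσ W W hW hW
  have hW' : W = 1 / 2 := by linarith
  rwa [hW'] at hW

end WiredDual

end Summit.CriticalPhenomena.CardyFormulaZ2.Cruxes.HalfPlaneMarkDensityLaw.SketchLine
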